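import Summits.AtomisticToContinuum.HydrodynamicLimit.Theorems.InformationPercolationEngineChaosClosesEulerReadoutMeasurable
import HarnessLib

/-!
# Kinetic reduction (crux `ChaosClosesEuler`, stmt-AtomisticToContinuum-15141, line `Sketch`,
# stub `stub_kineticReduction`) — helper: finite grids, union bounds, windows

WHAT. The probabilistic and combinatorial glue of the reduction, free of any particle system:

* `exists_threshold_forall_fin` — finitely many in-probability inputs of the shape `∃ r₀ ∀ r < r₀ ∃ N₀ ∀ N ≥ N₀`
  (one per grid time) have a common threshold;
* `measure_le_of_avoid` — an event avoided by every point outside a finite family of events is bounded by the sum of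
  their bounds; `measure_iUnion_fin_le_mul` — a `Fin n`-indexed family each of probability `≤ δ₁` has union of
  probability `≤ n δ₁`;
* `exists_grid_index` — every time of `[0, L]` is within one mesh `L/n` above a grid time `g L/n`, `g ≤ n`;
* `exists_window_count` — a window `Δ'` is an integer multiple `(m+1)Δ` of a short window `Δ ≤ Δ₀`, `Δ < c`;
* `setIntegral_Icc_eq_sum_windows` — the integral over `[a, a + (m+1)Δ]` of an integrable profile is the sum of the
  integrals over the `m + 1` consecutive closed windows;
* `exists_hsDiameter_le` — the particle diameter `σ(N+1)^{-1/3}` is eventually below any positive level.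

No named fact is invoked.
-/

noncomputable section

namespace Summit.AtomisticToContinuum.HydrodynamicLimit.Theorems.ChaosClosesEulerReduction

open scoped BigOperators Topology Classical MeasureTheory ENNReal
open Filter Set MeasureTheory Function
open Literature.MathematicalPhysics.KineticTheory

/-! ## §1 Common thresholds for finitely many inputs -/

/-- **Finitely many inputs have a common threshold.** If for every index `g : Fin n` there is `r₀(g) > 0` such that
for all `0 < r < r₀(g)` there is `N₀` with `P g r N` for `N ≥ N₀`, then one `r₀ > 0` and (for each `r`) one `N₀` serve
all indices. [folklore] -/
theorem exists_threshold_forall_fin {n : ℕ} {P : Fin n → ℝ → ℕ → Prop}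
    (h : ∀ g : Fin n, ∃ r₀ : ℝ, 0 < r₀ ∧ ∀ r : ℝ, 0 < r → r < r₀ → ∃ N₀ : ℕ, ∀ N : ℕ, N₀ ≤ N → P g r N) :
    ∃ r₀ : ℝ, 0 < r₀ ∧ ∀ r : ℝ, 0 < r → r < r₀ → ∃ N₀ : ℕ, ∀ N : ℕ, N₀ ≤ N → ∀ g : Fin n, P g r N := by
  induction n with
  | zero => exact ⟨1, one_pos, fun r _ _ => ⟨0, fun N _ g => Fin.elim0 g⟩⟩
  | succ n ih =>
    obtain ⟨r₁, hr₁, H1⟩ := ih (P := fun g => P g.succ) fun g => h g.succ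
    obtain ⟨r₂, hr₂, H2⟩ := h 0
    refine ⟨min r₁ r₂, lt_min hr₁ hr₂, fun r hr hrr => ?_⟩
    obtain ⟨N₁, HN1⟩ := H1 r hr (hrr.trans_le (min_le_left _ _))
    obtain ⟨N₂, HN2⟩ := H2 r hr (hrr.trans_le (min_le_right _ _))
    refine ⟨max N₁ N₂, fun N hN g => ?_⟩
    refine Fin.cases ?_ (fun g' => ?_) g
    · exact HN2 N ((le_max_right _ _).trans hN)
    · exact HN1 N ((le_max_left _ _).trans hN) g'

/-! ## §2 Union bounds -/

/-- **A `Fin n`-indexed family of events each of probability `≤ δ₁` has union of probability `≤ n δ₁`.** [folklore] -/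
theorem measure_iUnion_fin_le_mul {Ω : Type*} [MeasurableSpace Ω] (P : Measure Ω) {n : ℕ} {E : Fin n → Set Ω}
    {δ₁ : ℝ} (h : ∀ g, P (E g) ≤ ENNReal.ofReal δ₁) :
    P (⋃ g, E g) ≤ ENNReal.ofReal (n * δ₁) := by
  calc P (⋃ g, E g) ≤ ∑ g, P (E g) := measure_iUnion_fintype_le P E
    _ ≤ ∑ _g : Fin n, ENNReal.ofReal δ₁ := Finset.sum_le_sum fun g _ => h g
    _ = n * ENNReal.ofReal δ₁ := by simp [Finset.sum_const, Finset.card_univ]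
    _ = ENNReal.ofReal (n * δ₁) := by rw [ENNReal.ofReal_mul (Nat.cast_nonneg n), ENNReal.ofReal_natCast]

/-- **An event avoided outside a finite family of events.** If `P (S i) ≤ ofReal (b i)` with `b i ≥ 0`, and every
point lying in none of the `S i` lies outside `D`, then `P D ≤ ofReal (∑ b i)`. [folklore] -/
theorem measure_le_of_avoid {Ω : Type*} [MeasurableSpace Ω] (P : Measure Ω) {m : ℕ} {S : Fin m → Set Ω} {b : Fin m → ℝ}
    (hb : ∀ i, 0 ≤ b i) (hS : ∀ i, P (S i) ≤ ENNReal.ofReal (b i)) {D : Set Ω}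
    (hD : ∀ z, (∀ i, z ∉ S i) → z ∉ D) : P D ≤ ENNReal.ofReal (∑ i, b i) := by
  have hsub : D ⊆ ⋃ i, S i := by
    intro z hz
    by_contra hcon
    simp only [Set.mem_iUnion, not_exists] at hcon
    exact hD z hcon hz
  calc P D ≤ P (⋃ i, S i) := measure_mono hsub
    _ ≤ ∑ i, P (S i) := measure_iUnion_fintype_le P S
    _ ≤ ∑ i, ENNReal.ofReal (b i) := Finset.sum_le_sum fun i _ => hS i
    _ = ENNReal.ofReal (∑ i, b i) := (ENNReal.ofReal_sum_of_nonneg fun i _ => hb i).symm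

/-! ## §3 Grids and windows -/

/-- **Every time of `[0, L]` lies within one mesh above a grid time**: for `n ≥ 1` there is `g ≤ n` with
`g (L/n) ≤ τ ≤ g (L/n) + L/n`. [folklore] -/
theorem exists_grid_index {L : ℝ} (hL : 0 ≤ L) {n : ℕ} (hn : 1 ≤ n) {τ : ℝ} (hτ : τ ∈ Icc 0 L) :
    ∃ g : Fin (n + 1), (g : ℝ) * (L / n) ≤ τ ∧ τ ≤ (g : ℝ) * (L / n) + L / n := by
  have hn0 : (0 : ℝ) < n := by exact_mod_cast hn
  rcases hL.eq_or_lt with hL0 | hLpos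
  · have hτ0 : τ = 0 := le_antisymm (hL0 ▸ hτ.2) hτ.1
    refine ⟨0, ?_, ?_⟩ <;> simp [← hL0, hτ0]
  · set h : ℝ := L / n with hh
    have hpos : 0 < h := div_pos hLpos hn0
    set k : ℕ := Nat.floor (τ / h) with hk
    have hk1 : (k : ℝ) ≤ τ / h := Nat.floor_le (div_nonneg hτ.1 hpos.le)
    have hk2 : τ / h < k + 1 := Nat.lt_floor_add_one _
    have hkn : k ≤ n := by
      have h1 : τ / h ≤ n := by
        rw [div_le_iff₀ hpos, hh]
        field_simp
        exact hτ.2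
      have h2 : (k : ℝ) ≤ n := hk1.trans h1
      exact_mod_cast h2
    refine ⟨⟨k, Nat.lt_succ_of_le hkn⟩, ?_, ?_⟩
    · show (k : ℝ) * h ≤ τ
      rwa [le_div_iff₀ hpos] at hk1
    · show τ ≤ (k : ℝ) * h + h
      have := (div_lt_iff₀ hpos).1 hk2
      linarith

/-- **A window is an integer multiple of a short window**: for `Δ', Δ₀, c > 0` there is `m ≥ 1` with
`Δ'/(m+1) ≤ Δ₀` and `Δ'/(m+1) < c`. [folklore] -/
theorem exists_window_count {Δ' Δ₀ c : ℝ} (hΔ₀ : 0 < Δ₀) (hc : 0 < c) :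
    ∃ m : ℕ, 1 ≤ m ∧ Δ' / (m + 1 : ℝ) ≤ Δ₀ ∧ Δ' / (m + 1 : ℝ) < c := by
  obtain ⟨m, hm⟩ := exists_nat_gt (max 1 (max (Δ' / Δ₀) (Δ' / c)))
  have hm1 : (1 : ℝ) < m := (le_max_left _ _).trans_lt hm
  have hmpos : (0 : ℝ) < m + 1 := by linarith
  refine ⟨m, by exact_mod_cast hm1.le, ?_, ?_⟩
  · rw [div_le_iff₀ hmpos]
    have h1 : Δ' / Δ₀ < m := ((le_max_left _ _).trans (le_max_right _ _)).trans_lt hm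
    rw [div_lt_iff₀ hΔ₀] at h1
    nlinarith
  · rw [div_lt_iff₀ hmpos]
    have h1 : Δ' / c < m := ((le_max_right _ _).trans (le_max_right _ _)).trans_lt hm
    rw [div_lt_iff₀ hc] at h1
    nlinarith

/-- **Consecutive closed windows.** For a profile integrable on `[a, a + (m+1)Δ]` (`Δ > 0`), the integral over the
whole interval is the sum of the integrals over the `m + 1` closed windows `[a + jΔ, a + (j+1)Δ]`. [folklore] -/
theorem setIntegral_Icc_eq_sum_windows {f : ℝ → ℝ} {a Δ : ℝ} (hΔ : 0 < Δ) (m : ℕ)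
    (hf : IntegrableOn f (Icc a (a + (m + 1 : ℕ) * Δ)) volume) :
    ∫ s in Icc a (a + (m + 1 : ℕ) * Δ), f s = ∑ j ∈ Finset.range (m + 1), ∫ s in Icc (a + j * Δ) (a + (j + 1) * Δ), f s := by
  -- through interval integrals
  have hconv : ∀ {c d : ℝ}, c ≤ d → ∫ s in Icc c d, f s = ∫ s in c..d, f s := fun hcd => by
    rw [integral_Icc_eq_integral_Ioc, intervalIntegral.integral_of_le hcd]
  have hle : ∀ j : ℕ, a + j * Δ ≤ a + (j + 1) * Δ := fun j => by nlinarith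
  have hmono : ∀ j : ℕ, a ≤ a + j * Δ := fun j => by have : (0 : ℝ) ≤ j := Nat.cast_nonneg j; nlinarith
  have hint : ∀ k < m + 1, IntervalIntegrable f volume (a + (k : ℕ) * Δ) (a + ((k + 1 : ℕ) : ℝ) * Δ) := by
    intro k hk
    have hsub : Icc (a + (k : ℕ) * Δ) (a + ((k + 1 : ℕ) : ℝ) * Δ) ⊆ Icc a (a + (m + 1 : ℕ) * Δ) := by
      refine Set.Icc_subset_Icc (hmono k) ?_
      have : ((k + 1 : ℕ) : ℝ) ≤ ((m + 1 : ℕ) : ℝ) := by exact_mod_cast hk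
      nlinarith
    have hI : IntegrableOn f (Icc (a + (k : ℕ) * Δ) (a + ((k + 1 : ℕ) : ℝ) * Δ)) volume := hf.mono_set hsub
    exact (intervalIntegrable_iff_integrableOn_Icc_of_le (by push_cast; exact hle k)).2 hI
  have hsum := intervalIntegral.sum_integral_adjacent_intervals hint
  simp only [Nat.cast_zero, zero_mul, add_zero] at hsum
  rw [hconv (by have : (0 : ℝ) ≤ ((m + 1 : ℕ) : ℝ) := Nat.cast_nonneg _; nlinarith), ← hsum]
  refine Finset.sum_congr rfl fun j _ => ?_
  rw [hconv (hle j)]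
  push_cast
  ring_nf

/-! ## §4 The particle diameter is eventually small -/

/-- **The diameter `σ (N+1)^{-1/3}` is eventually below any positive level.** [folklore] -/
theorem exists_hsDiameter_le (σ : ℝ) {e : ℝ} (he : 0 < e) :
    ∃ N₀ : ℕ, ∀ N : ℕ, N₀ ≤ N → hsDiameter σ N ≤ e := by
  have ht : Tendsto (fun x : ℝ => x ^ (-(1 / 3 : ℝ))) atTop (𝓝 0) := tendsto_rpow_neg_atTop (by norm_num)
  have ht' : Tendsto (fun N : ℕ => σ * (((N + 1 : ℕ) : ℝ)) ^ (-(1 / 3 : ℝ))) atTop (𝓝 (σ * 0)) := by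
    refine Tendsto.const_mul σ (ht.comp ?_)
    exact tendsto_natCast_atTop_atTop.comp (tendsto_add_atTop_nat 1)
  rw [mul_zero] at ht'
  have hev : ∀ᶠ N in atTop, σ * (((N + 1 : ℕ) : ℝ)) ^ (-(1 / 3 : ℝ)) ≤ e :=
    (ht'.eventually (Iic_mem_nhds he))
  obtain ⟨N₀, hN₀⟩ := eventually_atTop.1 hev
  exact ⟨N₀, fun N hN => hN₀ N hN⟩

/-! ## §5 The registered sub-goal -/

/-- **Registered sub-goal `stub_reductionEvents` (helper of `stub_kineticReduction`): a window is an integer multiple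
of a short window** — the shell's short window `Δ ≤ Δ₀` tiles the conclusion's window `Δ'`. [folklore] -/
theorem stub_reductionEvents : ∀ {Δ' Δ₀ c : ℝ}, 0 < Δ₀ → 0 < c → ∃ m : ℕ, 1 ≤ m ∧ Δ' / (m + 1 : ℝ) ≤ Δ₀ ∧ Δ' / (m + 1 : ℝ) < c :=
  fun hΔ₀ hc => exists_window_count hΔ₀ hc

end Summit.AtomisticToContinuum.HydrodynamicLimit.Theorems.ChaosClosesEulerReduction

end
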